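import Mathlib
import Summits.MatrixMultiplication.MatrixMultiplication.Theorems.LevelGradedCohnUmansLevelOneGL2DesignsTangencyNormPencil

/-!
# Norm-form ("unitary circle") pencils, III: the character identity and the square-root ceiling —
stub `stub_tangencySets` (crux `LevelOneGL2Designs`, stmt-MatrixMultiplication-14080), wall-breaker
axis 10/12 *Hermitian unital constructions*, generation 1

Parts I–II (`…TangencyNormPencil`, `…TangencyNormPencilRigidity`): the union of levels
`X_R = {x² − d y² ∈ R}` (`R ⊆ 𝔽_pˣ`, `p` odd, `d ≠ 0`) is a tangency set iff `R` is a *norm-clique*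
(`d·r(r − r')` a non-square for all `r ≠ r'` in `R`), and then carries `|X_R| ≥ |R|(p − 1)` flags of
the stub's format.  This file bounds norm-cliques, closing the analysis of the architecture:

* `quadraticChar_mul_of_normClique` — `χ(r)χ(r') = χ(−1)` for distinct elements of a norm-clique;
* `normClique_card_le_two` — so for `p ≡ 3 (mod 4)` a norm-clique has at most TWO elements: the
  circle/hyperbola architecture is empty for half of the primes;
* `normClique_isClique_or_isCoclique` / `normClique_of_paleyClique` — for `p ≡ 1 (mod 4)` a
  norm-clique is a Paley clique or coclique inside one residue class, and conversely every Paley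
  clique `C` gives norm-cliques of size `|C| − 1`;
* `normClique_card_sq_le`, `card_normPencil_sq_le` — hence `|R|² ≤ p + 1` and `|X_R|² ≤ (p + 1)³`:
  the architecture carries at most `(p+1)^{3/2}` flags and reaches the stub's `c·p^{3/2}` iff
  Paley cliques of order `c√p` exist along primes `p ≡ 1 (mod 4)` — the square-root barrier of the
  parabola pencils (`…TangencyParabolaLift`, `…TangencyConics`, `…StubTangencySetsPaleyLift`)
  reached a third time, from the unitary side of the Hermitian axis;
* `card_hyperbola` — for `d` a non-zero square every non-zero level is a hyperbola (an orbit of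
  the split torus) with exactly `p − 1` points; the circle count `p + 1` for `d` a non-square is
  `HermitianUnital.card_circle` of the sibling `…StubTangencySetsHermitianCircles` (axis-1 seat).

RELATION TO THE SIBLING FILES `…StubTangencySetsHermitianCircles(Rigidity)` (axis-1 seat, landed the
same hour): those treat the circle case (`d` a NON-square) — `circleUnion_srs`, `isSquare_of_privateLine`,
`charClique_card_le_two`, `exists_coclique_card_eq_of_charClique` and the classification of
`U₁`-invariant tangency sets; the present series works for EVERY `d ≠ 0` at once (so also for the
split torus / hyperbola pencils, whose asymptotic directions need the extra case in
`normPencil_rigidity`), states the clique condition on the non-square side (`d·r(r − r')`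
non-square ⇔ `r(r − r')·χ(d) = −1`), and adds the uniform ceiling `|R|² ≤ p + 1`, the converse
`normClique_of_paleyClique` and the hyperbola count.  Elementary (the clique–coclique bound
`|C||I| ≤ p` is re-derived inline); Mathlib plus part I; no new definitions.
-/

set_option linter.dupNamespace false

namespace Summit.MatrixMultiplication.MatrixMultiplication.Theorems.LevelOneGL2Designs.NormPencil

open Finset Matrix

variable {p : ℕ} [Fact p.Prime]

/-! ## The character identity and the square-root ceiling -/

/-- **Character identity for norm-cliques.**  If `d ≠ 0`, `r ≠ r'`, and both
`d·r(r − r')` and `d·r'(r' − r)` are non-squares, then `χ(r)χ(r') = χ(−1)` for the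
quadratic character `χ`: multiply the two conditions and cancel the squares `d²` and `(r − r')²`.
[elementary] -/
theorem quadraticChar_mul_of_normClique {d r r' : ZMod p} (hd : d ≠ 0)
    (hne : r ≠ r') (h1 : ¬ IsSquare (d * (r * (r - r'))))
    (h2 : ¬ IsSquare (d * (r' * (r' - r)))) :
    quadraticChar (ZMod p) r * quadraticChar (ZMod p) r' = quadraticChar (ZMod p) (-1) := by
  set χ := quadraticChar (ZMod p) with hχ
  have e1 : χ (d * (r * (r - r'))) = -1 := quadraticChar_neg_one_iff_not_isSquare.2 h1
  have e2 : χ (d * (r' * (r' - r))) = -1 := quadraticChar_neg_one_iff_not_isSquare.2 h2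
  have hsub : r - r' ≠ 0 := sub_ne_zero.2 hne
  have hd2 : χ d * χ d = 1 := by rw [← map_mul, ← sq]; exact quadraticChar_sq_one' hd
  have hs2 : χ (r - r') * χ (r - r') = 1 := by
    rw [← map_mul, ← sq]; exact quadraticChar_sq_one' hsub
  have hneg : χ (r' - r) = χ (-1) * χ (r - r') := by
    rw [← map_mul]; congr 1; ring
  have hm1 : χ (-1) * χ (-1) = 1 := by
    rw [← map_mul]; simp
  have hprod : χ (d * (r * (r - r'))) * χ (d * (r' * (r' - r))) = 1 := by
    rw [e1, e2]; norm_num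
  simp only [map_mul] at hprod
  rw [hneg] at hprod
  have key : χ (-1) * (χ r * χ r') = 1 := by
    have h : χ d * (χ r * χ (r - r')) * (χ d * (χ r' * (χ (-1) * χ (r - r')))) =
        (χ d * χ d) * (χ (r - r') * χ (r - r')) * (χ (-1) * (χ r * χ r')) := by ring
    rw [h, hd2, hs2, one_mul, one_mul] at hprod
    exact hprod
  calc χ r * χ r' = (χ (-1) * χ (-1)) * (χ r * χ r') := by rw [hm1, one_mul]
    _ = χ (-1) * (χ (-1) * (χ r * χ r')) := by ring
    _ = χ (-1) := by rw [key, mul_one]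

/-- **Norm-cliques when `−1` is a non-square have at most two elements** (`p ≡ 3 (mod 4)`):
by `quadraticChar_mul_of_normClique` any two distinct elements have opposite quadratic
characters, and three elements cannot be pairwise opposite. [elementary] -/
theorem normClique_card_le_two (hm : quadraticChar (ZMod p) (-1) = -1)
    (d : ZMod p) (hd : d ≠ 0) (R : Finset (ZMod p)) (hR0 : (0 : ZMod p) ∉ R)
    (hR : ∀ r ∈ R, ∀ r' ∈ R, r ≠ r' → ¬ IsSquare (d * (r * (r - r')))) : R.card ≤ 2 := by
  classical
  set χ := quadraticChar (ZMod p) with hχ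
  have hr0 : ∀ r ∈ R, r ≠ 0 := fun r hr h => hR0 (h ▸ hr)
  have hpair : ∀ r ∈ R, ∀ r' ∈ R, r ≠ r' → χ r * χ r' = -1 := fun r hr r' hr' hne => by
    rw [← hm]
    exact quadraticChar_mul_of_normClique hd hne (hR r hr r' hr' hne) (hR r' hr' r hr hne.symm)
  by_contra h3
  obtain ⟨x, hx, y, hy, z, hz, hxy, hxz, hyz⟩ := two_lt_card.1 (not_le.1 h3)
  have e1 := hpair x hx y hy hxy
  have e2 := hpair x hx z hz hxz
  have e3 := hpair y hy z hz hyz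
  have hy2 : χ y ^ 2 = 1 := quadraticChar_sq_one (hr0 y hy)
  have hxz' : χ x * χ z = 1 := by
    have h := congrArg₂ (· * ·) e1 e3
    have h' : χ x * χ z * χ y ^ 2 = 1 := by linear_combination h
    rwa [hy2, mul_one] at h'
  rw [hxz'] at e2
  norm_num at e2

/-- **Norm-cliques when `−1` is a square are Paley cliques or cocliques** (`p ≡ 1 (mod 4)`): all
elements of `R` have the same quadratic character `ε` (`quadraticChar_mul_of_normClique`), so
`χ(r − r') = −χ(d)·ε` is CONSTANT over distinct pairs — `R` is a clique (`+1`) or a coclique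
(`−1`) of the Paley graph, lying inside one residue class. [elementary] -/
theorem normClique_isClique_or_isCoclique (hm : quadraticChar (ZMod p) (-1) = 1)
    (d : ZMod p) (hd : d ≠ 0) (R : Finset (ZMod p)) (hR0 : (0 : ZMod p) ∉ R)
    (hR : ∀ r ∈ R, ∀ r' ∈ R, r ≠ r' → ¬ IsSquare (d * (r * (r - r')))) :
    (∀ x ∈ R, ∀ y ∈ R, x ≠ y → IsSquare (x - y)) ∨
      (∀ x ∈ R, ∀ y ∈ R, x ≠ y → ¬ IsSquare (x - y)) := by
  classical
  set χ := quadraticChar (ZMod p) with hχ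
  have hr0 : ∀ r ∈ R, r ≠ 0 := fun r hr h => hR0 (h ▸ hr)
  rcases R.eq_empty_or_nonempty with hRe | ⟨r₀, hr₀⟩
  · left
    simp [hRe]
  have hsame : ∀ r ∈ R, χ r = χ r₀ := by
    intro r hr
    by_cases h : r = r₀
    · rw [h]
    have e := quadraticChar_mul_of_normClique hd h (hR r hr r₀ hr₀ h) (hR r₀ hr₀ r hr (Ne.symm h))
    rw [← hχ, hm] at e
    have hr2 : χ r₀ ^ 2 = 1 := quadraticChar_sq_one (hr0 r₀ hr₀)
    linear_combination (χ r₀) * e - (χ r) * hr2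
  -- the common character of the differences
  have hη : ∀ r ∈ R, ∀ r' ∈ R, r ≠ r' → χ (r - r') = -(χ d * χ r₀) := by
    intro r hr r' hr' hne
    have e : χ (d * (r * (r - r'))) = -1 :=
      quadraticChar_neg_one_iff_not_isSquare.2 (hR r hr r' hr' hne)
    simp only [map_mul] at e
    rw [hsame r hr] at e
    have hd2 : χ d ^ 2 = 1 := quadraticChar_sq_one hd
    have hr2 : χ r₀ ^ 2 = 1 := quadraticChar_sq_one (hr0 r₀ hr₀)
    linear_combination (χ d * χ r₀) * e - (χ (r - r') * χ r₀ ^ 2) * hd2 - (χ (r - r')) * hr2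
  rcases quadraticChar_dichotomy hd with h1 | h1 <;>
    rcases quadraticChar_dichotomy (hr0 r₀ hr₀) with h2 | h2 <;>
    rw [← hχ] at h1 h2 <;> simp only [h1, h2] at hη <;> norm_num at hη
  · right
    exact fun x hx y hy hxy => quadraticChar_neg_one_iff_not_isSquare.1 (hη x hx y hy hxy)
  · left
    exact fun x hx y hy hxy =>
      (quadraticChar_one_iff_isSquare (sub_ne_zero.2 hxy)).1 (hη x hx y hy hxy)
  · left
    exact fun x hx y hy hxy =>
      (quadraticChar_one_iff_isSquare (sub_ne_zero.2 hxy)).1 (hη x hx y hy hxy)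
  · right
    exact fun x hx y hy hxy => quadraticChar_neg_one_iff_not_isSquare.1 (hη x hx y hy hxy)

/-- **The square-root ceiling for norm-cliques**: a norm-clique `R` (for any `d ≠ 0`, any prime
`p`) has `|R|² ≤ p + 1`.  For `p = 2` everything is a square (`|R| ≤ 1`); if `−1` is a non-square,
`|R| ≤ 2` (`normClique_card_le_two`); if `−1` is a square, `R` is a Paley clique or coclique
(`normClique_isClique_or_isCoclique`) and the clique–coclique bound `|C||I| ≤ p` (re-derived
inline; cf. `…TangencyParabolaLift.card_clique_mul_card_coclique_le`) gives `|R|² ≤ p`.  Hence the norm-pencil architecture carries at most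
`(p + 1)^{3/2}` flags and produces order `p^{3/2}` only from Paley cliques of order `√p`.
[elementary] -/
theorem normClique_card_sq_le (d : ZMod p) (hd : d ≠ 0) (R : Finset (ZMod p))
    (hR0 : (0 : ZMod p) ∉ R)
    (hR : ∀ r ∈ R, ∀ r' ∈ R, r ≠ r' → ¬ IsSquare (d * (r * (r - r')))) :
    R.card ^ 2 ≤ p + 1 := by
  classical
  have hp := (Fact.out : p.Prime)
  by_cases hp2 : p = 2
  · have h1 : R.card ≤ 1 := by
      rw [card_le_one]
      intro x hx y hy
      by_contra hxy
      exact hR x hx y hy hxy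
        (FiniteField.isSquare_of_char_two (by rw [ZMod.ringChar_zmod_n]; exact hp2) _)
    nlinarith
  have hF : ringChar (ZMod p) ≠ 2 := by rw [ZMod.ringChar_zmod_n]; exact hp2
  -- the clique–coclique bound `|C|·|I| ≤ p` (`(c, i) ↦ i − c` is injective on `C × I`),
  -- re-derived here so that this file depends on Mathlib and part I only
  have hcc : ∀ C I : Finset (ZMod p), (∀ x ∈ C, ∀ y ∈ C, x ≠ y → IsSquare (x - y)) →
      (∀ x ∈ I, ∀ y ∈ I, x ≠ y → ¬ IsSquare (x - y)) → C.card * I.card ≤ p := by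
    intro C I hC hI
    have hinj : Set.InjOn (fun ci : ZMod p × ZMod p => ci.2 - ci.1) ↑(C ×ˢ I) := by
      rintro ⟨c, i⟩ hci ⟨c', i'⟩ hci' h
      simp only [coe_product, Set.mem_prod, mem_coe] at hci hci'
      change i - c = i' - c' at h
      by_cases hii : i = i'
      · subst hii
        have hcc' : c = c' := by linear_combination -h
        rw [hcc']
      · have hcc' : c ≠ c' := fun hcc' => hii (by subst hcc'; linear_combination h)
        have h1 : IsSquare (c - c') := hC c hci.1 c' hci'.1 hcc'
        have h2 : ¬ IsSquare (i - i') := hI i hci.2 i' hci'.2 hii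
        exact absurd (by rwa [show i - i' = c - c' by linear_combination h]) h2
    calc C.card * I.card = (C ×ˢ I).card := (card_product _ _).symm
      _ ≤ (univ : Finset (ZMod p)).card :=
          card_le_card_of_injOn _ (fun _ _ => mem_coe.mpr (mem_univ _)) hinj
      _ = p := by rw [card_univ, ZMod.card]
  -- multiplying by a non-square swaps cliques and cocliques
  obtain ⟨ν, hν⟩ := FiniteField.exists_nonsquare hF
  have hν0 : ν ≠ 0 := fun h => hν (h ▸ IsSquare.zero)
  have hswap : ∀ x y : ZMod p, x ≠ y → (IsSquare (ν * x - ν * y) ↔ ¬ IsSquare (x - y)) := by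
    intro x y hxy
    rw [← mul_sub, ← quadraticChar_one_iff_isSquare (mul_ne_zero hν0 (sub_ne_zero.2 hxy)),
      ← quadraticChar_neg_one_iff_not_isSquare, map_mul,
      quadraticChar_neg_one_iff_not_isSquare.2 hν]
    rcases quadraticChar_dichotomy (sub_ne_zero.2 hxy) with h | h <;> rw [h] <;> norm_num
  have hcardν : (R.image (ν * ·)).card = R.card :=
    card_image_of_injective _ (mul_right_injective₀ hν0)
  rcases quadraticChar_dichotomy (neg_ne_zero.2 (one_ne_zero' (ZMod p))) with hm | hm
  · -- `-1` a square: Paley clique or coclique, `|R|² ≤ p`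
    suffices h : R.card * R.card ≤ p by nlinarith
    rcases normClique_isClique_or_isCoclique hm d hd R hR0 hR with hC | hI
    · have hI : ∀ x ∈ R.image (ν * ·), ∀ y ∈ R.image (ν * ·), x ≠ y → ¬ IsSquare (x - y) := by
        simp only [mem_image]
        rintro _ ⟨x, hx, rfl⟩ _ ⟨y, hy, rfl⟩ hne
        have hxy : x ≠ y := fun h => hne (by rw [h])
        exact fun hsq => (hswap x y hxy).1 hsq (hC x hx y hy hxy)
      simpa [hcardν] using hcc R _ hC hI
    · have hC : ∀ x ∈ R.image (ν * ·), ∀ y ∈ R.image (ν * ·), x ≠ y → IsSquare (x - y) := by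
        simp only [mem_image]
        rintro _ ⟨x, hx, rfl⟩ _ ⟨y, hy, rfl⟩ hne
        have hxy : x ≠ y := fun h => hne (by rw [h])
        exact (hswap x y hxy).2 (hI x hx y hy hxy)
      simpa [hcardν] using hcc _ R hC hI
  · -- `-1` a non-square: `|R| ≤ 2`
    have h2 := normClique_card_le_two hm d hd R hR0 hR
    have hp3 : 3 ≤ p := by
      have := hp.two_le
      omega
    nlinarith


/-- **Ceiling of the norm-pencil architecture**: for `p` odd, `d ≠ 0` and a norm-clique
`R ⊆ 𝔽_p ∖ {0}`, the pencil `X_R = {v : Q v ∈ R}` — hence the SRS of `normPencil_srs` — has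
`|X_R|² ≤ (p + 1)³`, i.e. at most `(p+1)^{3/2}` flags (`card_pencil_bounds` and
`normClique_card_sq_le`), against the stub's demand `c·p^{3/2}`: the architecture can meet the
demand only through norm-cliques, i.e. Paley cliques, of order `√p`. [elementary] -/
theorem card_normPencil_sq_le (d : ZMod p) (hd : d ≠ 0) (hp2 : p ≠ 2) (R : Finset (ZMod p))
    (hR0 : (0 : ZMod p) ∉ R)
    (hR : ∀ r ∈ R, ∀ r' ∈ R, r ≠ r' → ¬ IsSquare (d * (r * (r - r')))) :
    (univ.filter fun v : Fin 2 → ZMod p => v 0 ^ 2 - d * v 1 ^ 2 ∈ R).card ^ 2 ≤ (p + 1) ^ 3 := by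
  have h1 := (card_pencil_bounds d hd hp2 R hR0).2
  have h2 := normClique_card_sq_le d hd R hR0 hR
  calc (univ.filter fun v : Fin 2 → ZMod p => v 0 ^ 2 - d * v 1 ^ 2 ∈ R).card ^ 2
      ≤ (R.card * (p + 1)) ^ 2 := Nat.pow_le_pow_left h1 2
    _ = R.card ^ 2 * (p + 1) ^ 2 := by ring
    _ ≤ (p + 1) * (p + 1) ^ 2 := Nat.mul_le_mul_right _ h2
    _ = (p + 1) ^ 3 := by ring

/-! ## Norm-cliques from Paley cliques; hyperbolas -/

/-- **Paley cliques feed the architecture.**  If `C ⊆ 𝔽_p` (`p` odd) has all differences of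
distinct elements squares (a clique of the Paley graph, stated for ordered pairs) and `c₀ ∈ C`,
then `R = (C − c₀) ∖ {0}` is a norm-clique for every non-square `d`, of size `|C| − 1`: for
`r = x − c₀ ≠ r' = y − c₀`, `d·r·(r − r') = d·(x − c₀)·(x − y)` is a non-square times two non-zero
squares.  So norm-cliques of size `c√p` along primes `p ≡ 1 (mod 4)` are EQUIVALENT to Paley
cliques of that order (converse: `normClique_isClique_or_isCoclique`, and a coclique times a
non-square is a clique). [elementary] -/
theorem normClique_of_paleyClique (hp2 : p ≠ 2) (C : Finset (ZMod p))
    (hC : ∀ x ∈ C, ∀ y ∈ C, x ≠ y → IsSquare (x - y)) {c₀ : ZMod p} (hc₀ : c₀ ∈ C) :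
    ∃ (d : ZMod p) (R : Finset (ZMod p)), d ≠ 0 ∧ (0 : ZMod p) ∉ R ∧
      (∀ r ∈ R, ∀ r' ∈ R, r ≠ r' → ¬ IsSquare (d * (r * (r - r')))) ∧ R.card + 1 = C.card := by
  classical
  have hF : ringChar (ZMod p) ≠ 2 := by rw [ZMod.ringChar_zmod_n]; exact hp2
  obtain ⟨d, hd⟩ := FiniteField.exists_nonsquare hF
  have hd0 : d ≠ 0 := fun h => hd (h ▸ IsSquare.zero)
  refine ⟨d, (C.erase c₀).image (· - c₀), hd0, ?_, ?_, ?_⟩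
  · simp only [mem_image, mem_erase, not_exists, not_and, and_imp]
    intro x hx _ h
    exact hx (sub_eq_zero.1 h)
  · simp only [mem_image, mem_erase]
    rintro _ ⟨x, ⟨hx0, hx⟩, rfl⟩ _ ⟨y, ⟨-, hy⟩, rfl⟩ hne hsq
    have hxy : x ≠ y := fun h => hne (by rw [h])
    have h1 : quadraticChar (ZMod p) (x - c₀) = 1 :=
      (quadraticChar_one_iff_isSquare (sub_ne_zero.2 hx0)).2 (hC x hx c₀ hc₀ hx0)
    have h2 : quadraticChar (ZMod p) (x - y) = 1 :=
      (quadraticChar_one_iff_isSquare (sub_ne_zero.2 hxy)).2 (hC x hx y hy hxy)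
    have h3 : quadraticChar (ZMod p) d = -1 := quadraticChar_neg_one_iff_not_isSquare.2 hd
    have hne0 : d * ((x - c₀) * (x - c₀ - (y - c₀))) ≠ 0 := by
      refine mul_ne_zero hd0 (mul_ne_zero (sub_ne_zero.2 hx0) ?_)
      rw [sub_sub_sub_cancel_right]
      exact sub_ne_zero.2 hxy
    have h4 := (quadraticChar_one_iff_isSquare hne0).2 hsq
    rw [map_mul, map_mul, sub_sub_sub_cancel_right, h1, h2, h3] at h4
    norm_num at h4
  · rw [card_image_of_injOn (fun x _ y _ h => sub_left_injective h), card_erase_add_one hc₀]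

/-- **Hyperbolas have `p − 1` points.**  If `d = e²` with `e ≠ 0` (`p` odd) then the zero level
`x² = d y²` is the union of the two lines `x = ±e y` (`2p − 1` points), and every non-zero level
`x² − d y² = r` — a hyperbola, an orbit of the split torus — has exactly `p − 1` points. [folklore] -/
theorem card_hyperbola (hp2 : p ≠ 2) {d e : ZMod p} (he : e ≠ 0) (hde : d = e ^ 2) {r : ZMod p}
    (hr : r ≠ 0) :
    (univ.filter fun v : Fin 2 → ZMod p => v 0 ^ 2 - d * v 1 ^ 2 = r).card = p - 1 := by
  classical
  have hd0 : d ≠ 0 := by rw [hde]; exact pow_ne_zero 2 he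
  have h2 : (2 : ZMod p) ≠ 0 := Ring.two_ne_zero (by rw [ZMod.ringChar_zmod_n]; exact hp2)
  -- the zero level is the union of the two lines `v₀ = ± e v₁`
  have hline : ∀ s : ZMod p, (univ.filter fun v : Fin 2 → ZMod p => v 0 = s * v 1).card = p := by
    intro s
    have heq : (univ.filter fun v : Fin 2 → ZMod p => v 0 = s * v 1) =
        univ.image fun t : ZMod p => (![s * t, t] : Fin 2 → ZMod p) := by
      ext v
      simp only [mem_filter, mem_univ, true_and, mem_image]
      constructor
      · intro h
        refine ⟨v 1, ?_⟩
        funext i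
        fin_cases i
        · simp [h]
        · simp
      · rintro ⟨t, rfl⟩
        simp
    rw [heq, card_image_of_injective _ (fun t t' h => by simpa using congrFun h 1), card_univ,
      ZMod.card]
  have hL0 : (univ.filter fun v : Fin 2 → ZMod p => v 0 ^ 2 - d * v 1 ^ 2 = 0).card = 2 * p - 1 := by
    set Lp := univ.filter fun v : Fin 2 → ZMod p => v 0 = e * v 1 with hLp
    set Lm := univ.filter fun v : Fin 2 → ZMod p => v 0 = -e * v 1 with hLm
    have hunion : (univ.filter fun v : Fin 2 → ZMod p => v 0 ^ 2 - d * v 1 ^ 2 = 0) = Lp ∪ Lm := by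
      ext v
      simp only [hLp, hLm, mem_filter, mem_univ, true_and, mem_union]
      rw [sub_eq_zero, hde, show e ^ 2 * v 1 ^ 2 = (e * v 1) ^ 2 by ring, neg_mul]
      exact sq_eq_sq_iff_eq_or_eq_neg
    have hinter : (Lp ∩ Lm).card = 1 := by
      rw [card_eq_one]
      refine ⟨0, eq_singleton_iff_unique_mem.2 ⟨by simp [hLp, hLm], fun v hv => ?_⟩⟩
      simp only [hLp, hLm, mem_inter, mem_filter, mem_univ, true_and] at hv
      have hv1 : v 1 = 0 := by
        have h3 : (2 * e) * v 1 = 0 := by linear_combination -hv.1 + hv.2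
        exact (mul_eq_zero.1 h3).resolve_left (mul_ne_zero h2 he)
      have hv0 : v 0 = 0 := by rw [hv.1, hv1, mul_zero]
      funext i
      fin_cases i
      · exact hv0
      · exact hv1
    have hie := card_union_add_card_inter Lp Lm
    rw [hinter, ← hunion, hLp, hline e, hLm, hline (-e)] at hie
    omega
  -- count as in `card_level_bounds`: `(2p − 1) + (p − 1)·N = p²`
  set N := (univ.filter fun v : Fin 2 → ZMod p => v 0 ^ 2 - d * v 1 ^ 2 = r).card with hN
  have hsum := sum_card_level (p := p) d
  rw [← Finset.add_sum_erase _ _ (mem_univ (0 : ZMod p)), hL0] at hsum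
  have hconst : ∑ c ∈ (univ : Finset (ZMod p)).erase 0,
      (univ.filter fun v : Fin 2 → ZMod p => v 0 ^ 2 - d * v 1 ^ 2 = c).card =
      ∑ _c ∈ (univ : Finset (ZMod p)).erase 0, N := by
    refine Finset.sum_congr rfl fun c hc => ?_
    exact card_level_eq_card_level d hd0 hp2 (ne_of_mem_erase hc) hr
  rw [hconst, sum_const, card_erase_of_mem (mem_univ _), card_univ, ZMod.card, smul_eq_mul]
    at hsum
  have hp2' : 2 ≤ p := (Fact.out : p.Prime).two_le
  obtain ⟨m, rfl⟩ : ∃ m, p = m + 1 := ⟨p - 1, by omega⟩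
  simp only [Nat.add_sub_cancel] at hsum ⊢
  have h21 : 2 * (m + 1) - 1 = 2 * m + 1 := by omega
  rw [h21] at hsum
  have key : m * N = m * m := by linear_combination hsum
  exact Nat.eq_of_mul_eq_mul_left (by omega) key

end Summit.MatrixMultiplication.MatrixMultiplication.Theorems.LevelOneGL2Designs.NormPencil
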